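/-
Origin: expansion seat `planner-pub-hodgecm-pv02-g8-0`, handover #4 v2 2026-08-18T15:16:58Z SUPERSEDES v1 4b1762c0 (md5 06a0dee0f93a9e68b534548623ead083, 446 l., 60 decls; NEW additive KERNEL leaf; imports my #3 + pv14-g6's RUN-31 row `SchwartzLinearFlowDeriv` (t31-pv14g6 row 1, src md5 7563deb5) => TWO rewrites `import Pv02g8.WeilThetaModelAdjoinCenter` -> `import HodgeCM.Automorphic.WeilThetaModelAdjoinCenter` and `import Pv14g6.SchwartzLinearFlowDeriv` -> `i (`HOME/pub-hodgecm-pv02-g8/lean/Pv02g8/WeilThetaModelDilation.lean`, md5 06a0dee0, 446 lines);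
landed by the gen-8 packager in gate run 31 as `HodgeCM/Automorphic/WeilThetaModelDilation.lean` (import ^import Pv02g8\.WeilThetaModelAdjoinCenter[ \t]*$→import HodgeCM.Automorphic.WeilThetaModelAdjoinCenter ×1; import ^import Pv14g6\.SchwartzLinearFlowDeriv[ \t]*$→import HodgeCM.Automorphic.SchwartzLinearFlowDeriv ×1).
-/
import Summits.HodgeConjecture.HodgeCM.Automorphic.WeilThetaModelAdjoinCenter
import Summits.HodgeConjecture.HodgeCM.Automorphic.SchwartzLinearFlowDeriv_2

/-
  HodgeCM/Automorphic/WeilThetaModelDilation.lean   (seat of origin: pub-hodgecm-pv02-g8, DAG-NODE PROVER #02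
  generation 8, lane (A); WIP module `Pv02g8.WeilThetaModelDilation`, session planner-pub-hodgecm-pv02-g8-0,
  2026-08-18).  PACKAGER: TWO rewrites — `import Pv02g8.WeilThetaModelAdjoinCenter` ↦
  `import HodgeCM.Automorphic.WeilThetaModelAdjoinCenter` (this seat's handover #3) and
  `import Pv14g6.SchwartzLinearFlowDeriv` ↦ `import HodgeCM.Automorphic.SchwartzLinearFlowDeriv` (pv14-g6's RUN-31
  row, source md5 7563deb5); lands AFTER both.  KERNEL only: nothing cited enters as a hypothesis, nothing is
  asserted, no placeholders.

# The dilation Weil theta model: a NON-COMPACT one-parameter subgroup acting through `ω`, and its `smooth` clause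

## What and why

The `smooth` clause of the S4 record ([SETUP D5′]; pv11-g9 `LinSmoothSide.smooth`, pv06-g7 `HypSmoothSide.hF`,
typed at the model level by pv02-g7's `HasSKDerivAt`) is needed, at the places `b ∈ Σ₁₂`, along HYPERBOLIC
(non-compact) one-parameter subgroups of `U(W_b) ≅ U(2,1)` (pv06-g7 `ArchCHyperbolic`: ONE such direction `X₁`
per place suffices).  Every model-level derivative in the tree so far is along a CENTRAL or a HEISENBERG
direction.  This file builds the toy real-place model in which a genuinely non-compact, non-Heisenberg
one-parameter subgroup acts through `ω`, and proves its `smooth` clause on every Schwartz vector: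

* `Dil` (§1): the group `ℝ` of dilation parameters, written multiplicatively, with the DISCRETE topology
  (`Dil.of t`); it acts on `Heis V` by the symplectic automorphisms
  **`dilAut V : Dil →* MulAut (Heis V)`, `φ_t(a, b, u) = (e^{-t} a, e^{t} b, u)`** (§2, `dilAut_of_apply_a/b/u`;
  they fix the centre, `dilAut_center`), and on `𝓢(V, ℂ)` by
  **`dilOp V : Dil →* (𝓢(V, ℂ) →L[ℂ] 𝓢(V, ℂ))ˣ`, `π_t Φ = Φ(e^{t} ·)`** (§3, Mathlib's
  `SchwartzMap.compCLMOfContinuousLinearEquiv ℂ (dilation V t)` with pv14-g6's `dilation V t = e^t • 1`);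
* **`dil_intertwines : Intertwines V m (dilAut V) (dilOp V)`** (§4): `ρ_m(φ_t h) = π_t ∘ ρ_m(h) ∘ π_t⁻¹` — the
  metaplectic covariance of the Schrödinger representation under the split torus `A` of `Sp(V ⊕ V)`, by a direct
  computation with `repCLM_apply`;
* **`dilationModel V L m Γz hΓz : WeilThetaModel U(1) Γz (Heis V ⋊[dilAut V] Dil) (inl(arith L m))`** (§5) :=
  `adjoinCenterModel` of handover #3 — the toy "Jacobi parabolic" `P = Heis V ⋊ A` ACTING through `ω = ρ_m ⋊ π`
  (`dilationModel_omg_inr(_mk) : ω(inr (Dil.of t))Φ = Φ ∘ (e^t • ·)`); linear, `ω` multiplicative;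
* **`hasSKDerivAt_dilationModel_of (Φ : 𝓢(V, ℂ)) :
     HasSKDerivAt (fun s => ω (inr (Dil.of s)) ⟨Φ, _⟩) ⟨flowGen 1 Φ, _⟩ 0`** (§6) — EVERY Schwartz vector is a
  differentiable vector of the model along the dilation subgroup, IN THE SCHWARTZ TOPOLOGY, with derivative the
  Euler operator `(flowGen 1 Φ)(x) = DΦ(x)[x]` (pv14-g6 `tendsto_compCLM_sub_div_ofReal` + handover #3's
  dictionary `hasSKDerivAt_adjoinCenterModel_inr_iff`); the literal `smooth`-clause form
  `tendsto_dilationModel_of_sub_smul`; at every parameter `hasSKDerivAt_dilationModel_of_at` (pv02-g7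
  `hasSKDerivAt_orbit_of_zero`); and along the "parabolic" product curve `s ↦ inl(γ_{a,b,c}(s)) · inr(Dil.of s)`
  — not a one-parameter subgroup — the derivative `dρ_m(a,b,c)Φ + flowGen 1 Φ`
  (`hasSKDerivAt_dilationModel_heis_mul_of`, the Leibniz rule `hasSKDerivAt_omg_mul_of_eq_one` of handover #1 on a
  non-commutative, non-compact pair);
* (§7) the theta KERNEL along the flow, `hasDerivAt_θ_dilationModel_of` (pv02-g7 `hasDerivAt_θ_apply`), and at
  the base point the bare theta series: **`hasDerivAt_tsum_schwartz_dilation (Φ : 𝓢(V, ℂ)) (s₀ : ℝ) :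
  HasDerivAt (fun s => Σ' v : L, Φ (e^s • v)) (Σ' v : L, (flowGen 1 Φ) (e^{s₀} • v)) s₀`** — differentiation
  UNDER the theta series along a non-compact flow as a corollary of the structural laws (`θ_cont` = n° 39 +
  continuity of `Θ_L`), with no termwise domination argument: PerL's step v5 l. 517 in the toy model.

HONEST LABEL.  (i) `Dil` carries the DISCRETE topology: Weil's n° 39 joint continuity (`actionContinuous`) is
then pv14-g5's `continuous_repSD_uncurry`; joint continuity of `(t, Φ) ↦ Φ(e^t ·)` for the real topology of `t`
is NOT claimed (pv14-g6's local equicontinuity estimates `seminorm_compCLM_sub_le` would give it).  The derivative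
statements do not see the topology of `Dil` (they are about curves `ℝ → 𝓢(V, ℂ)`); only the Leibniz rule needs a
continuous factor, and it is applied with the Heisenberg factor as the continuous one.  (ii) The dilations do NOT
fix the theta distribution of `L` and are not rational points of the model (`rat = thetaStabSD ⊇ inl(arith)`):
this is a model of the archimedean ACTION, as [SETUP D5′] requires, not a new automorphy statement.  (iii) Toy
real place: `Heis V ⋊ A ⊂` the Jacobi group, not `U(W_b)(L_v) ≅ U(2,1)`; the dictionary `X₁ ∈ 𝔭_b ↔` a split torus
of `U(2,1)` is pv06 / pv12's printed material and is not formalised here.  Nothing of PerL, QW8 or the 2001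
programme is used or claimed.
-/

set_option autoImplicit false

noncomputable section

open Topology Filter

open scoped RealInnerProductSpace SchwartzMap

namespace HodgeCM
namespace SchwartzWeil

/-! ## 1. The dilation parameter group `Dil = ℝ` (multiplicative notation, discrete topology) -/

/-- The group `ℝ` of dilation parameters, written multiplicatively, with the DISCRETE topology. -/
def Dil : Type := Multiplicative ℝ

namespace Dil

/-- (Ported verbatim from the HodgeCMPerL package; no docstring in the source.) -/
instance instCommGroup : CommGroup Dil := inferInstanceAs (CommGroup (Multiplicative ℝ))

/-- (Ported verbatim from the HodgeCMPerL package; no docstring in the source.) -/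
instance instTopologicalSpace : TopologicalSpace Dil := ⊥

/-- (Ported verbatim from the HodgeCMPerL package; no docstring in the source.) -/
instance instDiscreteTopology : DiscreteTopology Dil := ⟨rfl⟩

/-- The dilation parameter `t`, as an element of `Dil`. -/
def of (t : ℝ) : Dil := Multiplicative.ofAdd t

/-- The real parameter of an element of `Dil`. -/
def log (d : Dil) : ℝ := Multiplicative.toAdd (show Multiplicative ℝ from d)

/-- (Ported verbatim from the HodgeCMPerL package; no docstring in the source.) -/
@[simp] theorem log_of (t : ℝ) : log (of t) = t := rfl

/-- (Ported verbatim from the HodgeCMPerL package; no docstring in the source.) -/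
@[simp] theorem of_log (d : Dil) : of (log d) = d := rfl

/-- (Ported verbatim from the HodgeCMPerL package; no docstring in the source.) -/
theorem of_add (s t : ℝ) : of (s + t) = of s * of t := rfl

/-- (Ported verbatim from the HodgeCMPerL package; no docstring in the source.) -/
@[simp] theorem of_zero : of 0 = 1 := rfl

/-- (Ported verbatim from the HodgeCMPerL package; no docstring in the source.) -/
@[simp] theorem log_one : log 1 = 0 := rfl

/-- (Ported verbatim from the HodgeCMPerL package; no docstring in the source.) -/
@[simp] theorem log_mul (d d' : Dil) : log (d * d') = log d + log d' := rfl

/-- (Ported verbatim from the HodgeCMPerL package; no docstring in the source.) -/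
@[simp] theorem log_inv (d : Dil) : log d⁻¹ = -log d := rfl

end Dil

/-! ## 2. The action of `Dil` on the Heisenberg group by symplectic automorphisms -/

section Aut

variable (V : Type*) [NormedAddCommGroup V] [InnerProductSpace ℝ V]

/-- `φ_t(a, b, u) = (e^{-t} a, e^{t} b, u)`: an automorphism of `Heis V` (the symplectic pairing `⟪a, b'⟫` is
preserved). -/
def dilAutEquiv (t : ℝ) : MulAut (Heis V) where
  toFun h := ⟨Real.exp (-t) • h.a, Real.exp t • h.b, h.u⟩
  invFun h := ⟨Real.exp t • h.a, Real.exp (-t) • h.b, h.u⟩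
  left_inv h := by
    ext
    · simp only [smul_smul, ← Real.exp_add, add_neg_cancel, Real.exp_zero, one_smul]
    · simp only [smul_smul, ← Real.exp_add, neg_add_cancel, Real.exp_zero, one_smul]
    · rfl
  right_inv h := by
    ext
    · simp only [smul_smul, ← Real.exp_add, neg_add_cancel, Real.exp_zero, one_smul]
    · simp only [smul_smul, ← Real.exp_add, add_neg_cancel, Real.exp_zero, one_smul]
    · rfl
  map_mul' h h' := by
    ext
    · simp only [Heis.mul_a, smul_add]
    · simp only [Heis.mul_b, smul_add]
    · simp only [Heis.mul_u, real_inner_smul_left, real_inner_smul_right, ← mul_assoc, ← Real.exp_add,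
        add_neg_cancel, Real.exp_zero, one_mul]

/-- (Ported verbatim from the HodgeCMPerL package; no docstring in the source.) -/
@[simp] theorem dilAutEquiv_apply_a (t : ℝ) (h : Heis V) : (dilAutEquiv V t h).a = Real.exp (-t) • h.a := rfl

/-- (Ported verbatim from the HodgeCMPerL package; no docstring in the source.) -/
@[simp] theorem dilAutEquiv_apply_b (t : ℝ) (h : Heis V) : (dilAutEquiv V t h).b = Real.exp t • h.b := rfl

/-- (Ported verbatim from the HodgeCMPerL package; no docstring in the source.) -/
@[simp] theorem dilAutEquiv_apply_u (t : ℝ) (h : Heis V) : (dilAutEquiv V t h).u = h.u := rfl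

/-- **`dilAut : Dil →* MulAut (Heis V)`**, `t ↦ φ_t`. -/
def dilAut : Dil →* MulAut (Heis V) :=
  MonoidHom.mk' (fun d => dilAutEquiv V (Dil.log d)) (by
    intro d d'
    ext h
    · simp only [dilAutEquiv_apply_a, Dil.log_mul, MulAut.mul_apply, smul_smul, ← Real.exp_add, neg_add]
    · simp only [dilAutEquiv_apply_b, Dil.log_mul, MulAut.mul_apply, smul_smul, ← Real.exp_add]
    · simp only [dilAutEquiv_apply_u, MulAut.mul_apply])

/-- (Ported verbatim from the HodgeCMPerL package; no docstring in the source.) -/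
theorem dilAut_apply (d : Dil) : dilAut V d = dilAutEquiv V (Dil.log d) := rfl

/-- (Ported verbatim from the HodgeCMPerL package; no docstring in the source.) -/
@[simp] theorem dilAut_apply_a (d : Dil) (h : Heis V) : (dilAut V d h).a = Real.exp (-Dil.log d) • h.a := rfl

/-- (Ported verbatim from the HodgeCMPerL package; no docstring in the source.) -/
@[simp] theorem dilAut_apply_b (d : Dil) (h : Heis V) : (dilAut V d h).b = Real.exp (Dil.log d) • h.b := rfl

/-- (Ported verbatim from the HodgeCMPerL package; no docstring in the source.) -/
@[simp] theorem dilAut_apply_u (d : Dil) (h : Heis V) : (dilAut V d h).u = h.u := rfl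

/-- (Ported verbatim from the HodgeCMPerL package; no docstring in the source.) -/
theorem dilAut_of_apply_a (t : ℝ) (h : Heis V) : (dilAut V (Dil.of t) h).a = Real.exp (-t) • h.a := rfl

/-- (Ported verbatim from the HodgeCMPerL package; no docstring in the source.) -/
theorem dilAut_of_apply_b (t : ℝ) (h : Heis V) : (dilAut V (Dil.of t) h).b = Real.exp t • h.b := rfl

/-- The dilations fix the centre pointwise. -/
theorem dilAut_center (d : Dil) (z : Circle) : dilAut V d (Heis.center z) = Heis.center z := by
  ext
  · simp only [dilAut_apply_a, Heis.center_a, smul_zero]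
  · simp only [dilAut_apply_b, Heis.center_b, smul_zero]
  · rfl

/-- Each `φ_d` is continuous. -/
theorem continuous_dilAut (d : Dil) : Continuous (dilAut V d : Heis V → Heis V) :=
  Heis.continuous_mk (Heis.continuous_a.const_smul _) (Heis.continuous_b.const_smul _) Heis.continuous_u

/-- (Ported verbatim from the HodgeCMPerL package; no docstring in the source.) -/
instance isTopologicalGroup_heisSD_dil : IsTopologicalGroup (Heis V ⋊[dilAut V] Dil) :=
  HeisSD.isTopologicalGroup (continuous_dilAut V)

end Aut

/-! ## 3. The action of `Dil` on `𝓢(V, ℂ)`: `π_t Φ = Φ(e^t ·)` -/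

section Op

variable (V : Type*) [NormedAddCommGroup V] [InnerProductSpace ℝ V]

/-- `π_t Φ = Φ ∘ (e^t • ·)` as a unit of `End(𝓢(V, ℂ))`, with inverse `π_{-t}`. -/
def dilOpUnit (t : ℝ) : (𝓢(V, ℂ) →L[ℂ] 𝓢(V, ℂ))ˣ where
  val := SchwartzMap.compCLMOfContinuousLinearEquiv ℂ (dilation V t)
  inv := SchwartzMap.compCLMOfContinuousLinearEquiv ℂ (dilation V (-t))
  val_inv := by
    ext Φ x
    simp only [mul_apply_eq_comp, SchwartzMap.compCLMOfContinuousLinearEquiv_apply, Function.comp_apply,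
      dilation_apply, smul_smul, ← Real.exp_add, neg_add_cancel, Real.exp_zero, one_smul, one_apply_eq_self]
  inv_val := by
    ext Φ x
    simp only [mul_apply_eq_comp, SchwartzMap.compCLMOfContinuousLinearEquiv_apply, Function.comp_apply,
      dilation_apply, smul_smul, ← Real.exp_add, add_neg_cancel, Real.exp_zero, one_smul, one_apply_eq_self]

/-- (Ported verbatim from the HodgeCMPerL package; no docstring in the source.) -/
@[simp] theorem dilOpUnit_val_apply (t : ℝ) (Φ : 𝓢(V, ℂ)) (x : V) :
    (dilOpUnit V t : 𝓢(V, ℂ) →L[ℂ] 𝓢(V, ℂ)) Φ x = Φ (Real.exp t • x) := rfl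

/-- (Ported verbatim from the HodgeCMPerL package; no docstring in the source.) -/
theorem dilOpUnit_val (t : ℝ) :
    (dilOpUnit V t : 𝓢(V, ℂ) →L[ℂ] 𝓢(V, ℂ)) = SchwartzMap.compCLMOfContinuousLinearEquiv ℂ (dilation V t) := rfl

/-- **`dilOp : Dil →* (𝓢(V, ℂ) →L[ℂ] 𝓢(V, ℂ))ˣ`**, `t ↦ π_t`. -/
def dilOp : Dil →* (𝓢(V, ℂ) →L[ℂ] 𝓢(V, ℂ))ˣ :=
  MonoidHom.mk' (fun d => dilOpUnit V (Dil.log d)) (by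
    intro d d'
    ext Φ x
    simp only [Dil.log_mul, Units.val_mul, mul_apply_eq_comp, dilOpUnit_val_apply, smul_smul, ← Real.exp_add,
      add_comm])

/-- (Ported verbatim from the HodgeCMPerL package; no docstring in the source.) -/
theorem dilOp_apply (d : Dil) : dilOp V d = dilOpUnit V (Dil.log d) := rfl

/-- (Ported verbatim from the HodgeCMPerL package; no docstring in the source.) -/
@[simp] theorem dilOp_val_apply (d : Dil) (Φ : 𝓢(V, ℂ)) (x : V) :
    (dilOp V d : 𝓢(V, ℂ) →L[ℂ] 𝓢(V, ℂ)) Φ x = Φ (Real.exp (Dil.log d) • x) := rfl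

/-- (Ported verbatim from the HodgeCMPerL package; no docstring in the source.) -/
theorem dilOp_of_val (t : ℝ) :
    (dilOp V (Dil.of t) : 𝓢(V, ℂ) →L[ℂ] 𝓢(V, ℂ)) = SchwartzMap.compCLMOfContinuousLinearEquiv ℂ (dilation V t) :=
  rfl

/-- (Ported verbatim from the HodgeCMPerL package; no docstring in the source.) -/
theorem dilOp_of_val_apply (t : ℝ) (Φ : 𝓢(V, ℂ)) (x : V) :
    (dilOp V (Dil.of t) : 𝓢(V, ℂ) →L[ℂ] 𝓢(V, ℂ)) Φ x = Φ (Real.exp t • x) := rfl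

/-- (Ported verbatim from the HodgeCMPerL package; no docstring in the source.) -/
theorem compCLMOfContinuousLinearEquiv_dilation_apply (t : ℝ) (Φ : 𝓢(V, ℂ)) (x : V) :
    SchwartzMap.compCLMOfContinuousLinearEquiv ℂ (dilation V t) Φ x = Φ (Real.exp t • x) := rfl

/-- (Ported verbatim from the HodgeCMPerL package; no docstring in the source.) -/
@[simp] theorem dilOp_of_zero_val_apply (Φ : 𝓢(V, ℂ)) :
    (dilOp V (Dil.of 0) : 𝓢(V, ℂ) →L[ℂ] 𝓢(V, ℂ)) Φ = Φ := by
  ext x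
  rw [dilOp_of_val_apply, Real.exp_zero, one_smul]

end Op

/-! ## 4. The dilations intertwine the Schrödinger representation -/

section Intertwine

variable (V : Type) [NormedAddCommGroup V] [InnerProductSpace ℝ V] [FiniteDimensional ℝ V] [MeasurableSpace V]
  [BorelSpace V] (m : ℤ)

/-- The covariance `ρ_m(φ_t h) (Φ(e^t ·)) = (ρ_m(h) Φ)(e^t ·)`, pointwise. -/
theorem repCLM_dilAut_dilOp_apply (d : Dil) (h : Heis V) (Φ : 𝓢(V, ℂ)) (x : V) :
    repCLM V m (dilAut V d h) ((dilOp V d : 𝓢(V, ℂ) →L[ℂ] 𝓢(V, ℂ)) Φ) x =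
      (dilOp V d : 𝓢(V, ℂ) →L[ℂ] 𝓢(V, ℂ)) (repCLM V m h Φ) x := by
  have h1 : Real.exp (Dil.log d) • (x - Real.exp (-Dil.log d) • h.a) = Real.exp (Dil.log d) • x - h.a := by
    rw [smul_sub, smul_smul, ← Real.exp_add, add_neg_cancel, Real.exp_zero, one_smul]
  have h2 : ⟪(m : ℝ) • Real.exp (Dil.log d) • h.b, x⟫ = ⟪(m : ℝ) • h.b, Real.exp (Dil.log d) • x⟫ := by
    rw [real_inner_smul_left, real_inner_smul_left, real_inner_smul_left, real_inner_smul_right, mul_left_comm]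
  rw [repCLM_apply, dilOp_val_apply, dilOp_val_apply, repCLM_apply, dilAut_apply_a, dilAut_apply_b, dilAut_apply_u,
    h1, h2]

/-- **`Intertwines V m (dilAut V) (dilOp V)`**: `ρ_m(φ_d h) = π_d ∘ ρ_m(h) ∘ π_d⁻¹` — pv14-g5's intertwining
condition for the split torus of `Sp(V ⊕ V)` acting by dilations. -/
theorem dil_intertwines : Intertwines V m (dilAut V) (dilOp V) := by
  intro d h
  rw [eq_mul_inv_iff_mul_eq]
  ext Φ x
  rw [Units.val_mul, Units.val_mul, mul_apply_eq_comp, mul_apply_eq_comp, val_repUnits, val_repUnits]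
  exact repCLM_dilAut_dilOp_apply V m d h Φ x

end Intertwine

/-! ## 5. The dilation Weil theta model -/

section Model

variable (V : Type) [NormedAddCommGroup V] [InnerProductSpace ℝ V] [FiniteDimensional ℝ V] [MeasurableSpace V]
  [BorelSpace V] (L : Submodule ℤ V) [DiscreteTopology L] (m : ℤ) (Γz : Subgroup Circle)
  (hΓz : ∀ z ∈ Γz, z ^ m = 1)

omit [DiscreteTopology L] in
/-- `inl(arith L m)` lies in the theta stabiliser (Weil's Théorème 6 for the Heisenberg part). -/
theorem map_inl_arith_le_thetaStabSD :
    (arith V L m).map (SemidirectProduct.inl : Heis V →* Heis V ⋊[dilAut V] Dil) ≤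
      thetaStabSD V L m (dil_intertwines V m) :=
  Subgroup.map_le_iff_le_comap.mpr fun _ hγ => inl_mem_thetaStabSD V L m (dil_intertwines V m) hγ

/-- **The dilation Weil theta model**: `G_U ↦ U(1)` (rational points `Γz ⊆ μ_m`), `U(W) ↦ Heis V ⋊[φ] Dil` — the
toy Jacobi parabolic `Heis ⋊ A` — ACTING through `ω = ρ_m ⋊ π` on `𝓢(V, ℂ)`, `U(W)(L₀) ↦ inl(arith L m)`. -/
def dilationModel :
    HodgeCM.WeilThetaModel Circle Γz (Heis V ⋊[dilAut V] Dil)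
      ((arith V L m).map (SemidirectProduct.inl : Heis V →* Heis V ⋊[dilAut V] Dil)) :=
  adjoinCenterModel V L m (dilAut_center V) (dil_intertwines V m) Γz hΓz _ (map_inl_arith_le_thetaStabSD V L m)

/-- (Ported verbatim from the HodgeCMPerL package; no docstring in the source.) -/
theorem dilationModel_def : dilationModel V L m Γz hΓz =
    adjoinCenterModel V L m (dilAut_center V) (dil_intertwines V m) Γz hΓz _ (map_inl_arith_le_thetaStabSD V L m) :=
  rfl

/-- (Ported verbatim from the HodgeCMPerL package; no docstring in the source.) -/
@[simp] theorem dilationModel_SK : (dilationModel V L m Γz hΓz).SK = Set.univ := rfl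

/-- (Ported verbatim from the HodgeCMPerL package; no docstring in the source.) -/
instance linearStr_dilationModel : (dilationModel V L m Γz hΓz).LinearStr :=
  linearStr_adjoinCenterModel V L m _ _ Γz hΓz _ _

/-- (Ported verbatim from the HodgeCMPerL package; no docstring in the source.) -/
instance continuousSMul_dilationModel : ContinuousSMul ℂ (dilationModel V L m Γz hΓz).W.SX :=
  inferInstanceAs (ContinuousSMul ℂ 𝓢(V, ℂ))

/-- (Ported verbatim from the HodgeCMPerL package; no docstring in the source.) -/
instance continuousAdd_dilationModel : ContinuousAdd (dilationModel V L m Γz hΓz).W.SX :=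
  inferInstanceAs (ContinuousAdd 𝓢(V, ℂ))

/-- (Ported verbatim from the HodgeCMPerL package; no docstring in the source.) -/
instance t2Space_dilationModel : T2Space (dilationModel V L m Γz hΓz).W.SX :=
  inferInstanceAs (T2Space 𝓢(V, ℂ))

/-- `ω(x)Φ = ρ_m(x.left) (π_{x.right} Φ)`. -/
theorem dilationModel_omg (x : Heis V ⋊[dilAut V] Dil) (Φ : (dilationModel V L m Γz hΓz).SK) :
    ((dilationModel V L m Γz hΓz).omg x Φ).1 =
      (repSD V m (dil_intertwines V m) x : 𝓢(V, ℂ) →L[ℂ] 𝓢(V, ℂ)) Φ.1 :=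
  adjoinCenterModel_omg V L m _ _ Γz hΓz _ _ x Φ

/-- **The dilation subgroup acts through `ω`**: `ω(inr (Dil.of t)) Φ = Φ(e^t ·)`. -/
theorem dilationModel_omg_inr (t : ℝ) (Φ : (dilationModel V L m Γz hΓz).SK) :
    ((dilationModel V L m Γz hΓz).omg (SemidirectProduct.inr (Dil.of t)) Φ).1 =
      SchwartzMap.compCLMOfContinuousLinearEquiv ℂ (dilation V t) Φ.1 :=
  adjoinCenterModel_omg_inr V L m _ _ Γz hΓz _ _ (Dil.of t) Φ

/-- The same on a bare Schwartz function: `ω(inr (Dil.of t)) Φ = Φ ∘ (e^t • ·)`; pointwise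
`(SchwartzMap.compCLMOfContinuousLinearEquiv ℂ (dilation V t) Φ) x = Φ (Real.exp t • x)` holds by `rfl`
(`SchwartzMap.compCLMOfContinuousLinearEquiv_apply`, pv14-g6 `dilation_apply`). -/
theorem dilationModel_omg_inr_mk (t : ℝ) (Φ : 𝓢(V, ℂ)) :
    (dilationModel V L m Γz hΓz).omg (SemidirectProduct.inr (Dil.of t)) ⟨Φ, Set.mem_univ Φ⟩ =
      ⟨SchwartzMap.compCLMOfContinuousLinearEquiv ℂ (dilation V t) Φ, Set.mem_univ _⟩ :=
  adjoinCenterModel_omg_inr_mk V L m _ _ Γz hΓz _ _ (Dil.of t) Φ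

/-- Heisenberg elements act by `ρ_m`. -/
theorem dilationModel_omg_inl (h : Heis V) (Φ : (dilationModel V L m Γz hΓz).SK) :
    ((dilationModel V L m Γz hΓz).omg (SemidirectProduct.inl h) Φ).1 = repCLM V m h Φ.1 :=
  adjoinCenterModel_omg_inl V L m _ _ Γz hΓz _ _ h Φ

/-- `ω` is multiplicative. -/
theorem dilationModel_omg_mul (x y : Heis V ⋊[dilAut V] Dil) (Φ : (dilationModel V L m Γz hΓz).SK) :
    (dilationModel V L m Γz hΓz).omg (x * y) Φ =
      (dilationModel V L m Γz hΓz).omg x ((dilationModel V L m Γz hΓz).omg y Φ) :=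
  adjoinCenterModel_omg_mul V L m _ _ Γz hΓz _ _ x y Φ

/-! ## 6. The `smooth` clause along the dilation subgroup -/

/-- **Every Schwartz vector is a differentiable vector of the dilation model along the (non-compact) dilation
subgroup, in the Schwartz topology, with derivative the Euler operator `x · ∇Φ`.** -/
theorem hasSKDerivAt_dilationModel_of (Φ : 𝓢(V, ℂ)) :
    (dilationModel V L m Γz hΓz).HasSKDerivAt
      (fun s => (dilationModel V L m Γz hΓz).omg (SemidirectProduct.inr (Dil.of s)) ⟨Φ, Set.mem_univ Φ⟩)
      ⟨flowGen (1 : V →L[ℝ] V) Φ, Set.mem_univ _⟩ 0 := by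
  refine (hasSKDerivAt_adjoinCenterModel_inr_iff V L m _ _ Γz hΓz _ _ (fun s => Dil.of s) Φ _).mpr ?_
  refine (tendsto_compCLM_sub_div_ofReal (coe_dilation_zero V) (hasDerivAt_coe_dilation V) Φ).congr fun s => ?_
  rw [dilOp_of_val, dilOp_of_zero_val_apply]


-- port_pkg: scope closed for this part
end Model
end SchwartzWeil
end HodgeCM
end
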